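import Summits.Ventures.LatticeQCDFlow.Scaling.LadderRobinMode

/-!
HONEST FRAMING: exact (Metropolis-corrected) sampling algorithms for lattice gauge theory; figures
of merit are autocorrelation/cost numbers at stated couplings and volumes; no continuum-physics
claim.

# LadderRobinModeBounds — THE ROBIN MODE FROM BELOW: `c_k > 0` AND `c_0 ≤ c_k` FOR EVERY LEVEL, `c_0 ≥ t/(√2·K(2K+1))` (`h ≤ 1`), AND THE RATE FROM BELOW
# **`ρ ≥ min{t/(K(2K+1)²), 2√2·h/(π²(K+1))}`** — THE CEILING-SIDE CONSTANTS OF THE HOMOGENEOUS LADDER (lean-2 GEN-47, ours)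

Venture-side (OURS).  Cell `lqcd-flow` (pub-lqcd), unit `pub-lqcd-lean-2-g47`, 2026-08-31.  Chapter AG, file 5 — Mathlib only, companion of file 1 (`Scaling/LadderRobinMode`).  File 1
bounded the Robin mode `c_n = cos(θ(K+½−n))` and its rate `ρ = (2t/K)(1 − cos θ)` from ABOVE (the floor side).  The ceiling side (files 6–9: the mode is an exact, positive Lyapunov
weight on the stale set) needs the opposite bounds, all by a two-case analysis on whether `θ(2K+1) ≤ π/2`: (i) every `c_k`, `k ≤ K`, is positive and at least `c_0` (the cosine
decreases on `[0, π/2]`); (ii) **`c_0 ≥ t/(√2·K(2K+1))`** when `h ≤ 1` (if `θ(K+½) ≤ π/4` then `c_0 ≥ cos(π/4)`; otherwise the Robin equation in product form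
`h·c_0 = (2t/K)·sin(θ(K+1))·sin(θ/2)` with `sin(θ(K+1)) ≥ √2/2` — as `|π/2 − θ(K+1)| ≤ π/4` — and `sin(θ/2) ≥ θ/π ≥ 1/(2(2K+1))`); (iii) **`ρ ≥ min{t/(K(2K+1)²),
2√2·h/(π²(K+1))}`** (if `θ(2K+1) ≥ π/2` the first, by `4tθ² ≤ π²Kρ`... read backwards: `ρ ≥ 4tθ²/(π²K)`; otherwise `c_0 > √2/2` and the Robin equation gives `θ² ≥ h·c_0·K/(t(K+1))`).
Hypothesis-equations `hc`, `hρ`, `hrobin` as in file 1; no definitions.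

* `robinMode_robin_product` (the Robin equation in product form), **`robinMode_c_pos`**, **`robinMode_c0_le`** (`c_0 ≤ c_k`), `robinMode_sum_le` (`Σ_kc_k ≤ K+1`),
  **`robinMode_c0_ge`** (`t ≤ √2·K(2K+1)·c_0`), **`robinMode_rho_ge_swap`** (`θ(2K+1) ≥ π/2 ⇒ t ≤ K(2K+1)²ρ`), **`robinMode_rho_ge_hot`** (`θ(2K+1) ≤ π/2 ⇒ 2√2h ≤ π²(K+1)ρ`),
  **`robinMode_rho_ge_min`**.

Reading (no numerics implied): the slowest one-level mode relaxes at rate at least `min{t/(K(2K+1)²), 2√2h/(π²(K+1))}` per step — the swap channel OR the hot refresh, whichever is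
slower; for a hot rate `h ≳ t/K²` the swap channel decides and the rate is `Θ(t/K³)` from both sides (file 1: `ρ ≤ tπ²/(K(2K+1)²)`).  Literature grade (cell rule): ELEMENTARY, NEW
TYPING; nothing cited; no new bib keys.
-/

noncomputable section

open Finset Real

namespace Summit.Ventures.LatticeQCDFlow.Scaling

section RobinModeBounds
variable {K : ℕ} {t h θ ρ : ℝ} {c : ℕ → ℝ}

/-- **The Robin equation in product form:** `h·c_0 = (2t/K)·sin(θ(K+1))·sin(θ/2)`. [ours] -/
theorem robinMode_robin_product (hc : ∀ n : ℕ, c n = Real.cos (θ * ((K : ℝ) + 1 / 2 - n)))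
    (hrobin : h * Real.cos (θ * ((K : ℝ) + 1 / 2)) = t / K * (Real.cos (θ * ((K : ℝ) + 1 / 2)) - Real.cos (θ * ((K : ℝ) + 3 / 2)))) :
    h * c 0 = 2 * t / K * Real.sin (θ * ((K : ℝ) + 1)) * Real.sin (θ / 2) := by
  have h0 : c 0 = Real.cos (θ * ((K : ℝ) + 1 / 2)) := by rw [hc]; push_cast; ring_nf
  have hdiff : Real.cos (θ * ((K : ℝ) + 1 / 2)) - Real.cos (θ * ((K : ℝ) + 3 / 2)) = 2 * Real.sin (θ * ((K : ℝ) + 1)) * Real.sin (θ / 2) := by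
    rw [Real.cos_sub_cos]
    have e1 : (θ * ((K : ℝ) + 1 / 2) + θ * ((K : ℝ) + 3 / 2)) / 2 = θ * ((K : ℝ) + 1) := by ring
    have e2 : (θ * ((K : ℝ) + 1 / 2) - θ * ((K : ℝ) + 3 / 2)) / 2 = -(θ / 2) := by ring
    rw [e1, e2, Real.sin_neg]; ring
  rw [h0, hrobin, hdiff]; ring

/-- **Every entry of the mode is positive** on the ladder: `0 < c_k` for `k ≤ K` (`0 < θ`, `θ(2K+1) < π`). [ours] -/
theorem robinMode_c_pos (hθ0 : 0 < θ) (hθ1 : θ * (2 * K + 1) < π) (hc : ∀ n : ℕ, c n = Real.cos (θ * ((K : ℝ) + 1 / 2 - n))) {k : ℕ} (hk : k ≤ K) :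
    0 < c k := by
  have hk' : (k : ℝ) ≤ K := by exact_mod_cast hk
  rw [hc]
  refine Real.cos_pos_of_mem_Ioo ⟨by nlinarith [Real.pi_pos], by nlinarith⟩

/-- **The hot entry is the smallest:** `c_0 ≤ c_k` for `k ≤ K` (the cosine decreases on `[0, π]`). [ours] -/
theorem robinMode_c0_le (hθ0 : 0 < θ) (hθ1 : θ * (2 * K + 1) < π) (hc : ∀ n : ℕ, c n = Real.cos (θ * ((K : ℝ) + 1 / 2 - n))) {k : ℕ} (hk : k ≤ K) :
    c 0 ≤ c k := by
  have hk' : (k : ℝ) ≤ K := by exact_mod_cast hk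
  rw [hc, hc]
  push_cast
  refine Real.cos_le_cos_of_nonneg_of_le_pi (by nlinarith) (by nlinarith [Real.pi_pos]) (by nlinarith)

/-- `Σ_{k ≤ K} c_k ≤ K+1`. [ours] -/
theorem robinMode_sum_le (hc : ∀ n : ℕ, c n = Real.cos (θ * ((K : ℝ) + 1 / 2 - n))) : ∑ k : Fin (K + 1), c k ≤ (K : ℝ) + 1 := by
  calc ∑ k : Fin (K + 1), c k ≤ ∑ _k : Fin (K + 1), (1 : ℝ) := sum_le_sum fun k _ => by rw [hc]; exact Real.cos_le_one _
    _ = (K : ℝ) + 1 := by rw [sum_const, card_univ, Fintype.card_fin, nsmul_eq_mul, mul_one]; push_cast; ring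

/-- **THE HOT ENTRY FROM BELOW: `t ≤ √2·K(2K+1)·c_0`** (`K ≥ 1`, `0 < t ≤ 1`, `0 < h ≤ 1`; two cases on `θ(2K+1) ≤ π/2`). [ours] -/
theorem robinMode_c0_ge (hK : 1 ≤ K) (ht : 0 < t) (ht1 : t ≤ 1) (hh1 : h ≤ 1) (hθ0 : 0 < θ) (hθ1 : θ * (2 * K + 1) < π)
    (hc : ∀ n : ℕ, c n = Real.cos (θ * ((K : ℝ) + 1 / 2 - n)))
    (hrobin : h * Real.cos (θ * ((K : ℝ) + 1 / 2)) = t / K * (Real.cos (θ * ((K : ℝ) + 1 / 2)) - Real.cos (θ * ((K : ℝ) + 3 / 2)))) :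
    t ≤ Real.sqrt 2 * K * (2 * K + 1) * c 0 := by
  have hKpos : (0 : ℝ) < K := Nat.cast_pos.mpr (by omega)
  have hK1 : (1 : ℝ) ≤ K := by exact_mod_cast hK
  have h0 : c 0 = Real.cos (θ * ((K : ℝ) + 1 / 2)) := by rw [hc]; push_cast; ring_nf
  have hs2 : Real.sqrt 2 * Real.sqrt 2 = 2 := Real.mul_self_sqrt (by norm_num)
  have hs2pos : 0 < Real.sqrt 2 := Real.sqrt_pos.mpr (by norm_num)
  have hs2gt : 1 < Real.sqrt 2 := by nlinarith
  have hcos4 : Real.cos (π / 4) = Real.sqrt 2 / 2 := Real.cos_pi_div_four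
  obtain ⟨hc00, _⟩ := robinMode_c0_nonneg hθ0 hθ1 hc
  by_cases hcase : θ * (2 * K + 1) ≤ π / 2
  · -- `c_0 ≥ cos(π/4) = √2/2`
    have hc0 : Real.sqrt 2 / 2 ≤ c 0 := by
      rw [h0, ← hcos4]
      exact Real.cos_le_cos_of_nonneg_of_le_pi (by nlinarith) (by linarith [Real.pi_pos]) (by nlinarith)
    calc t ≤ 1 := ht1
      _ ≤ Real.sqrt 2 * 1 * (2 * 1 + 1) * (Real.sqrt 2 / 2) := by nlinarith
      _ ≤ Real.sqrt 2 * K * (2 * K + 1) * (Real.sqrt 2 / 2) := by gcongr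
      _ ≤ Real.sqrt 2 * K * (2 * K + 1) * c 0 := by gcongr
  · push Not at hcase
    have hprod := robinMode_robin_product hc hrobin
    -- `sin(θ(K+1)) ≥ √2/2`: `|π/2 − θ(K+1)| ≤ π/4`
    have hs1 : Real.sqrt 2 / 2 ≤ Real.sin (θ * ((K : ℝ) + 1)) := by
      rw [← Real.cos_pi_div_two_sub, ← hcos4, ← Real.cos_abs (π / 2 - θ * ((K : ℝ) + 1))]
      refine Real.cos_le_cos_of_nonneg_of_le_pi (abs_nonneg _) (by linarith [Real.pi_pos]) ?_
      rw [abs_le]; constructor <;> nlinarith [Real.pi_pos]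
    -- `sin(θ/2) ≥ θ/π ≥ 1/(2(2K+1))`
    have hs3 : 1 / (2 * (2 * (K : ℝ) + 1)) ≤ Real.sin (θ / 2) := by
      have hj := Real.mul_le_sin (show 0 ≤ θ / 2 by positivity) (by nlinarith [Real.pi_pos])
      have : 1 / (2 * (2 * (K : ℝ) + 1)) ≤ 2 / π * (θ / 2) := by
        rw [div_le_iff₀ (by positivity)]
        have e : 2 / π * (θ / 2) * (2 * (2 * (K : ℝ) + 1)) = (θ * (2 * K + 1)) * 2 / π := by ring
        rw [e, le_div_iff₀ Real.pi_pos]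
        linarith
      linarith
    -- `h·c_0 ≥ (2t/K)·(√2/2)·(1/(2(2K+1)))`
    have hlow : 2 * t / K * (Real.sqrt 2 / 2) * (1 / (2 * (2 * (K : ℝ) + 1))) ≤ h * c 0 := by
      rw [hprod]
      have := mul_le_mul hs1 hs3 (by positivity) (le_trans (by positivity) hs1)
      calc 2 * t / K * (Real.sqrt 2 / 2) * (1 / (2 * (2 * (K : ℝ) + 1))) = 2 * t / K * (Real.sqrt 2 / 2 * (1 / (2 * (2 * (K : ℝ) + 1)))) := by ring
        _ ≤ 2 * t / K * (Real.sin (θ * ((K : ℝ) + 1)) * Real.sin (θ / 2)) := mul_le_mul_of_nonneg_left this (by positivity)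
        _ = _ := by ring
    have hhc : h * c 0 ≤ c 0 := by nlinarith
    have e : 2 * t / K * (Real.sqrt 2 / 2) * (1 / (2 * (2 * (K : ℝ) + 1))) * (Real.sqrt 2 * K * (2 * K + 1)) = t := by
      field_simp; nlinarith [hs2]
    calc t = 2 * t / K * (Real.sqrt 2 / 2) * (1 / (2 * (2 * (K : ℝ) + 1))) * (Real.sqrt 2 * K * (2 * K + 1)) := e.symm
      _ ≤ (h * c 0) * (Real.sqrt 2 * K * (2 * K + 1)) := mul_le_mul_of_nonneg_right hlow (by positivity)
      _ ≤ c 0 * (Real.sqrt 2 * K * (2 * K + 1)) := mul_le_mul_of_nonneg_right hhc (by positivity)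
      _ = Real.sqrt 2 * K * (2 * K + 1) * c 0 := by ring

/-- **THE RATE FROM BELOW, SWAP-DOMINATED CASE:** `θ(2K+1) ≥ π/2 ⇒ t ≤ K(2K+1)²·ρ`. [ours] -/
theorem robinMode_rho_ge_swap (hK : 1 ≤ K) (ht : 0 < t) (hθ0 : 0 < θ) (hθ1 : θ * (2 * K + 1) < π) (hρ : ρ = 2 * t / K * (1 - Real.cos θ))
    (hcase : π / 2 ≤ θ * (2 * K + 1)) : t ≤ (K : ℝ) * (2 * K + 1) ^ 2 * ρ := by
  have hKpos : (0 : ℝ) < K := Nat.cast_pos.mpr (by omega)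
  have h1 := robinMode_theta_sq_le hK ht hθ0 hθ1 hρ
  -- `θ²(2K+1)² ≥ π²/4`
  have h2 : π ^ 2 / 4 ≤ (θ * (2 * K + 1)) ^ 2 := by
    have := pow_le_pow_left₀ (by positivity) hcase 2
    calc π ^ 2 / 4 = (π / 2) ^ 2 := by ring
      _ ≤ _ := this
  have hpi : 0 < π ^ 2 := by positivity
  -- `4tθ²(2K+1)² ≤ π²K(2K+1)²ρ` and `4tθ²(2K+1)² ≥ tπ²`
  have h3 : t * π ^ 2 ≤ 4 * t * (θ * (2 * K + 1)) ^ 2 := by nlinarith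
  have h4 : 4 * t * (θ * (2 * (K : ℝ) + 1)) ^ 2 ≤ π ^ 2 * K * ρ * (2 * K + 1) ^ 2 := by nlinarith
  nlinarith

/-- **THE RATE FROM BELOW, REFRESH-DOMINATED CASE:** `θ(2K+1) ≤ π/2 ⇒ 2√2·h ≤ π²(K+1)·ρ` (`c_0 ≥ √2/2` and the Robin equation `h·c_0 ≤ tθ²(K+1)/K`). [ours] -/
theorem robinMode_rho_ge_hot (hK : 1 ≤ K) (ht : 0 < t) (hh : 0 ≤ h) (hθ0 : 0 < θ) (hθ1 : θ * (2 * K + 1) < π)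
    (hc : ∀ n : ℕ, c n = Real.cos (θ * ((K : ℝ) + 1 / 2 - n))) (hρ : ρ = 2 * t / K * (1 - Real.cos θ))
    (hrobin : h * Real.cos (θ * ((K : ℝ) + 1 / 2)) = t / K * (Real.cos (θ * ((K : ℝ) + 1 / 2)) - Real.cos (θ * ((K : ℝ) + 3 / 2))))
    (hcase : θ * (2 * K + 1) ≤ π / 2) : 2 * Real.sqrt 2 * h ≤ π ^ 2 * ((K : ℝ) + 1) * ρ := by
  have hKpos : (0 : ℝ) < K := Nat.cast_pos.mpr (by omega)
  have h0 : c 0 = Real.cos (θ * ((K : ℝ) + 1 / 2)) := by rw [hc]; push_cast; ring_nf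
  have hs2 : Real.sqrt 2 * Real.sqrt 2 = 2 := Real.mul_self_sqrt (by norm_num)
  have hs2pos : 0 < Real.sqrt 2 := Real.sqrt_pos.mpr (by norm_num)
  have hc0 : Real.sqrt 2 / 2 ≤ c 0 := by
    rw [h0, ← Real.cos_pi_div_four]
    exact Real.cos_le_cos_of_nonneg_of_le_pi (by nlinarith) (by linarith [Real.pi_pos]) (by nlinarith)
  -- the Robin equation gives `h·c_0 ≤ tθ²(K+1)/K`
  have hprod := robinMode_robin_product hc hrobin
  have hs1 : Real.sin (θ * ((K : ℝ) + 1)) ≤ θ * ((K : ℝ) + 1) := Real.sin_le (by positivity)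
  have hs1' : 0 ≤ Real.sin (θ * ((K : ℝ) + 1)) := Real.sin_nonneg_of_nonneg_of_le_pi (by positivity) (by nlinarith [Real.pi_pos])
  have hs3 : Real.sin (θ / 2) ≤ θ / 2 := Real.sin_le (by positivity)
  have hs3' : 0 ≤ Real.sin (θ / 2) := Real.sin_nonneg_of_nonneg_of_le_pi (by positivity) (by nlinarith [Real.pi_pos])
  have hup : h * c 0 ≤ t * θ ^ 2 * ((K : ℝ) + 1) / K := by
    rw [hprod]
    have := mul_le_mul hs1 hs3 hs3' (by positivity)
    calc 2 * t / K * Real.sin (θ * ((K : ℝ) + 1)) * Real.sin (θ / 2) = 2 * t / K * (Real.sin (θ * ((K : ℝ) + 1)) * Real.sin (θ / 2)) := by ring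
      _ ≤ 2 * t / K * (θ * ((K : ℝ) + 1) * (θ / 2)) := mul_le_mul_of_nonneg_left this (by positivity)
      _ = t * θ ^ 2 * ((K : ℝ) + 1) / K := by field_simp
  -- `4tθ² ≤ π²Kρ`
  have hsq := robinMode_theta_sq_le hK ht hθ0 hθ1 hρ
  -- combine: `2√2 h ≤ 4 h c_0 / ... `; `h (√2/2) K ≤ h c_0 K ≤ t θ² (K+1)`, times `4/(π²)`: `4tθ²(K+1) ≤ π² K (K+1) ρ`
  have h1 : h * (Real.sqrt 2 / 2) * K ≤ t * θ ^ 2 * ((K : ℝ) + 1) := by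
    have := mul_le_mul_of_nonneg_left hc0 hh
    have h2 : h * c 0 * K ≤ t * θ ^ 2 * ((K : ℝ) + 1) := by
      rw [le_div_iff₀ hKpos] at hup; exact hup
    nlinarith
  have h2 : 4 * (t * θ ^ 2 * ((K : ℝ) + 1)) ≤ π ^ 2 * K * ρ * ((K : ℝ) + 1) := by nlinarith
  nlinarith

/-- **THE RATE FROM BELOW: `ρ ≥ min{t/(K(2K+1)²), 2√2·h/(π²(K+1))}`** (`K ≥ 1`, `t > 0`, `h ≥ 0`, at a Robin root). [ours] -/
theorem robinMode_rho_ge_min (hK : 1 ≤ K) (ht : 0 < t) (hh : 0 ≤ h) (hθ0 : 0 < θ) (hθ1 : θ * (2 * K + 1) < π)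
    (hc : ∀ n : ℕ, c n = Real.cos (θ * ((K : ℝ) + 1 / 2 - n))) (hρ : ρ = 2 * t / K * (1 - Real.cos θ))
    (hrobin : h * Real.cos (θ * ((K : ℝ) + 1 / 2)) = t / K * (Real.cos (θ * ((K : ℝ) + 1 / 2)) - Real.cos (θ * ((K : ℝ) + 3 / 2)))) :
    min (t / ((K : ℝ) * (2 * K + 1) ^ 2)) (2 * Real.sqrt 2 * h / (π ^ 2 * ((K : ℝ) + 1))) ≤ ρ := by
  have hKpos : (0 : ℝ) < K := Nat.cast_pos.mpr (by omega)
  by_cases hcase : π / 2 ≤ θ * (2 * K + 1)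
  · have h1 := robinMode_rho_ge_swap hK ht hθ0 hθ1 hρ hcase
    refine le_trans (min_le_left _ _) ?_
    rw [div_le_iff₀ (by positivity)]; linarith
  · push Not at hcase
    have h1 := robinMode_rho_ge_hot hK ht hh hθ0 hθ1 hc hρ hrobin hcase.le
    refine le_trans (min_le_right _ _) ?_
    rw [div_le_iff₀ (by positivity)]; linarith

end RobinModeBounds

end Summit.Ventures.LatticeQCDFlow.Scaling

end
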